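import Mathlib.NumberTheory.LocalField.Basic
import Mathlib.Topology.Algebra.Valued.WithVal
import Literature.NumberTheory.Automorphic.AdicCompletionCompact
import HarnessLib

/-!
# `K_v` is a non-archimedean local field (Mathlib's `IsNonarchimedeanLocalField`)

Topic `NumberTheory/Automorphic`; namespace `Literature.Automorphic`. For a Dedekind domain `R` with
fraction field `K` and a finite place `v`, the completion `K_v = v.adicCompletion K` carries
Mathlib's `Valued K_v ℤᵐ⁰` structure but, at the pin, no `ValuativeRel` / `IsValuativeTopology`
structure (Mathlib, `NumberTheory/Padics/HeightOneSpectrum.lean`: "after `adicCompletion` has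
`IsValuativeTopology` instance"), hence Mathlib's class `IsNonarchimedeanLocalField`
(`NumberTheory/LocalField/Basic.lean`: valuative topology + locally compact + non-trivial) cannot
even be stated for it. This file supplies the instances:

* `ValuativeRel (v.adicCompletion K)` — the valuative relation of the valuation `Valued.v`
  (Mathlib `ValuativeRel.ofValuation`), with `Valued.v.Compatible`;
* `IsValuativeTopology (v.adicCompletion K)` — the (valuation) topology of `K_v` is the valuative
  topology (same argument as Mathlib's instance for `WithVal v`,
  `Topology/Algebra/Valued/WithVal.lean`);
* for a number field `K`: `LocallyCompactSpace (v.adicCompletion K)` (the theorem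
  `locallyCompactSpace_adicCompletion` of `AdicCompletionCompact.lean`, registered as an instance),
  `ValuativeRel.IsNontrivial (v.adicCompletion K)`, and finally
  `IsNonarchimedeanLocalField (v.adicCompletion K)`: **the completion of a number field at a
  finite place is a non-archimedean local field** (Weil, *Basic Number Theory*, Ch. III §1:
  completions of an A-field of characteristic `0` at finite places are p-fields; Cassels–Fröhlich
  Ch. II §7).

With the last instance, Mathlib's local-field API (`IsNonarchimedeanLocalField.*`: compact and
complete valuation ring, finite residue field, `IsAdicComplete`, discreteness of the value group)
and the Literature facts stated for abstract non-archimedean local fields (e.g.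
`Literature/NumberTheory/GaloisRepresentations/LocalExistenceTheorem.lean`) apply to `K_v`.
None of these instances exists in Mathlib at the pin (no instance of `IsNonarchimedeanLocalField`
at all), so nothing is overridden or duplicated.

## References

* A. Weil, *Basic Number Theory* (1967), Ch. I §4 and Ch. III §1 (completions of A-fields at
  finite places are p-fields, i.e. non-discrete locally compact non-archimedean fields).
* J. W. S. Cassels, A. Fröhlich (eds.), *Algebraic Number Theory* (1967), Ch. II §7.
-/

noncomputable section

namespace Literature.NumberTheory.Automorphic

open IsDedekindDomain Valued
open scoped WithZero

section Dedekind

variable {R : Type*} [CommRing R] [IsDedekindDomain R] (K : Type*) [Field K] [Algebra R K]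
  [IsFractionRing R K] (v : HeightOneSpectrum R)

/-- The valuative relation on `K_v` defined by its valuation `Valued.v : K_v → ℤᵐ⁰`
(`x ≤ᵥ y ↔ v x ≤ v y`; Mathlib `ValuativeRel.ofValuation`). [folklore] -/
instance instValuativeRelAdicCompletion : ValuativeRel (v.adicCompletion K) :=
  .ofValuation (Valued.v : Valuation (v.adicCompletion K) ℤᵐ⁰)

/-- `Valued.v` is compatible with the valuative relation it defines. [folklore] -/
instance instCompatibleValuedAdicCompletion :
    (Valued.v : Valuation (v.adicCompletion K) ℤᵐ⁰).Compatible :=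
  .ofValuation _

/-- The topology of `K_v` is the valuative topology of its valuative relation (as for Mathlib's
`WithVal v`: neighbourhoods of `x` are the translates of the balls `{z | v z < γ}`,
`Valued.mem_nhds`, transported along the order isomorphism between the abstract value group and
the value group of `Valued.v`). [folklore] -/
instance instIsValuativeTopologyAdicCompletion : IsValuativeTopology (v.adicCompletion K) where
  mem_nhds_iff {s x} := by
    simp only [Set.image_add_left, Set.preimage_setOf_eq, Valued.mem_nhds]
    let e := ValuativeRel.ValueGroupWithZero.orderMonoidIso
      (Valued.v : Valuation (v.adicCompletion K) ℤᵐ⁰)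
    apply e.unitsCongr.symm.exists_congr fun a ↦ ?_
    simp [-OrderMonoidIso.val_unitsCongr_symm_apply, OrderMonoidIso.unitsCongr_symm_apply,
      e.lt_symm_apply, e, ← Valuation.restrict_def, sub_eq_neg_add]

/-- The valuative relation of `K_v` is non-trivial (the valuation `Valued.v` of `K_v` is
non-trivial: Mathlib `Valuation.IsNontrivial` for the rank-one discrete valuation of `K_v`).
[folklore] -/
instance instIsNontrivialAdicCompletion : ValuativeRel.IsNontrivial (v.adicCompletion K) :=
  (ValuativeRel.isNontrivial_iff_isNontrivial
    (Valued.v : Valuation (v.adicCompletion K) ℤᵐ⁰)).2 inferInstance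

end Dedekind

section NumberField

variable (K : Type*) [Field K] [NumberField K]
  (v : HeightOneSpectrum (NumberField.RingOfIntegers K))

/-- `K_v` is locally compact for a number field `K` (`locallyCompactSpace_adicCompletion`,
registered as an instance; Weil, BNT Ch. III §1). [folklore] -/
instance instLocallyCompactSpaceAdicCompletion : LocallyCompactSpace (v.adicCompletion K) :=
  locallyCompactSpace_adicCompletion K v

/-- **The completion of a number field at a finite place is a non-archimedean local field** in
the sense of Mathlib's `IsNonarchimedeanLocalField` (valuative topology, locally compact,
non-trivially valued): Weil, *Basic Number Theory*, Ch. III §1 (with Ch. I §4), Cassels–Fröhlich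
Ch. II §7.
[cite: WeilBNT1967, Ch. III §1 (completions of an A-field at finite places are p-fields)] -/
instance instIsNonarchimedeanLocalFieldAdicCompletion :
    IsNonarchimedeanLocalField (v.adicCompletion K) where

end NumberField

end Literature.NumberTheory.Automorphic
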